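import Mathlib
import Summits.ValiantsHypothesis.ValiantsHypothesis.Theorems.LiouvilleSarnakAlignedTypeICharactersMod2nBilinearSieveZeroFreeFinal
import HarnessLib
import Literature.NumberTheory.LFunctions.MoebiusCharacterSumsPowerfulModuli

/-!
# Route LiouvilleSarnak — support `AlignedTypeI` (stmt-ValiantsHypothesis-21040), line `characters_mod_2n`:
# the leaf from the PUBLISHED zero-free region for characters to `2`-power moduli (Banks–Shparlinski 2019, Thm 7.2)

`Theorems/LiouvilleSarnakAlignedTypeICharactersMod2nBilinearSieveZeroFreeFinal.lean` proved
`alignedTypeI_of_twoPowerZFR : HZ → AlignedTypeI`, where `HZ` is the zero-free-region hypothesis "for every `A`,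
eventually in `j`, the primitive `χ (mod 2^j)` have no zero `β + iγ` of `L(s, χ)` with `0 < β < 1`, `|γ| ≤ j³` and
`β > 1 − A log j / j`".  This file discharges `HZ` from the published zero-free region for Dirichlet `L`-functions to a
powerful modulus — Banks–Shparlinski 2019, Theorem 7.2 (originating with Postnikov 1956, Gallagher 1972, Iwaniec
1974), special case `q = 2^γ`, first clause: `L(s, χ) ≠ 0` for `σ > 1 − A/((log q)^{2/3} (log log q)^{1/3})`,
`|t| ≤ T = exp(B (log q)^{5/3} (log log q)^{1/3})` — stated below as the named literature fact
`BanksShparlinski2019_theorem72_twoPower` (NOT proved in the tree), and concludes the leaf BY NAME: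

* `twoPowerZFR_of_BS72` — `BanksShparlinski2019_theorem72_twoPower → HZ` (real analysis: with `x = log q = j log 2`,
  `(log x)⁴ / x → 0` gives `A' log j · x^{2/3} (log x)^{1/3} ≤ A j` and `j³ ≤ T` eventually);
* ★ `alignedTypeI_of_BS72` — `BanksShparlinski2019_theorem72_twoPower → AlignedTypeI`.

HONEST FRAMING. CONDITIONAL RESULT on ONE named published theorem (a zero-free region of Vinogradov–Korobov width for
the `2`-power moduli); with it the leaf `AlignedTypeI` rests on that zero-free region alone (the Linnik–Gallagher range,
the explicit-formula window and all bookkeeping are proved in the tree).  `AlignedTypeI` is NOT closed unconditionally;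
the cruxes `DigitalBilinearLiouville`, `LiouvilleCutRank`, `AlgebraicSarnak` stay OPEN; nothing here bears on `VP ≠ VNP`.

## References

* W. D. Banks, I. E. Shparlinski, *Sums with the Möbius function twisted by characters with powerful moduli*,
  Trans. Amer. Math. Soc. 373 (2020) 249–272 = arXiv:1801.10276, Theorem 7.2 (§7, p. 11).
  [cite: BanksShparlinski2019PowerfulModuli, Theorem 7.2]
* H. Iwaniec, *On zeros of Dirichlet's L series*, Invent. Math. 23 (1974) 97–104.
-/

set_option linter.dupNamespace false

noncomputable section

namespace Summit.ValiantsHypothesis.ValiantsHypothesis.Theorems.LiouvilleSarnak.AlignedTypeI.CharactersModTwoN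

open Filter Topology

/-- For every `ε > 0`, eventually `(log x)^4 ≤ ε x`. [folklore] -/
theorem exists_log_pow_four_le (ε : ℝ) (hε : 0 < ε) :
    ∃ x₀ : ℝ, ∀ x : ℝ, x₀ ≤ x → Real.log x ^ 4 ≤ ε * x := by
  have h := Real.tendsto_pow_log_div_mul_add_atTop 1 0 4 one_ne_zero
  have hev : ∀ᶠ x : ℝ in atTop, Real.log x ^ 4 / (1 * x + 0) < ε := (tendsto_order.1 h).2 ε hε
  obtain ⟨x₁, hx₁⟩ := Filter.eventually_atTop.1 hev
  refine ⟨max x₁ 1, fun x hx => ?_⟩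
  have hx1 : 1 ≤ x := le_trans (le_max_right _ _) hx
  have hxpos : 0 < x := by linarith
  have h1 := hx₁ x (le_trans (le_max_left _ _) hx)
  rw [add_zero, one_mul, div_lt_iff₀ hxpos] at h1
  exact h1.le

/-- Cube roots: if `0 ≤ L` and `L^4 ≤ c^3 · y` with `0 ≤ c`, `0 ≤ y`, then `L^{4/3} ≤ c · y^{1/3}`. [folklore] -/
theorem rpow_four_thirds_le {L c y : ℝ} (hL : 0 ≤ L) (hc : 0 ≤ c) (hy : 0 ≤ y)
    (h : L ^ 4 ≤ c ^ 3 * y) : L ^ (4 / 3 : ℝ) ≤ c * y ^ (1 / 3 : ℝ) := by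
  have h1 : L ^ (4 / 3 : ℝ) = (L ^ 4) ^ (1 / 3 : ℝ) := by
    rw [show (4 / 3 : ℝ) = (4 : ℕ) * (1 / 3 : ℝ) by norm_num, Real.rpow_mul hL, Real.rpow_natCast]
  have h2 : (c ^ 3 * y) ^ (1 / 3 : ℝ) = c * y ^ (1 / 3 : ℝ) := by
    rw [Real.mul_rpow (by positivity) hy]
    congr 1
    rw [show (c ^ 3 : ℝ) = c ^ ((3 : ℕ) : ℝ) by rw [Real.rpow_natCast], ← Real.rpow_mul hc]
    norm_num
  rw [h1, ← h2]
  exact Real.rpow_le_rpow (by positivity) h (by norm_num)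

/-! ### §2 `HZ` from the published zero-free region -/

/-- **`HZ` from Banks–Shparlinski 2019, Theorem 7.2.**  With `q = 2^j`, `x = log q = j log 2` and `L = log x`:
the zero-free width `A/(x^{2/3} L^{1/3})` beats `A' log j / j` for every `A'` eventually (since `log j ≤ 2L` and
`L^{4/3} = o(x^{1/3})`), and the height `j³` is below `T = exp(B x^{5/3} L^{1/3})` eventually. [folklore] -/
theorem twoPowerZFR_of_BS72 (h : Literature.NumberTheory.LFunctions.BanksShparlinski2019_theorem72_twoPower) :
    ∀ A : ℝ, 0 < A → ∃ j₀ : ℕ, ∀ j : ℕ, j₀ ≤ j → ∀ χ : DirichletCharacter ℂ (2 ^ j), χ.IsPrimitive →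
      ∀ ρ : ℂ, χ.LFunction ρ = 0 → 0 < ρ.re → ρ.re < 1 → |ρ.im| ≤ (j : ℝ) ^ 3 →
        ρ.re ≤ 1 - A * Real.log j / j := by
  intro A' hA'
  obtain ⟨γ₀, A, hA, B, hB, hZ⟩ := h
  -- `ε` serves both comparisons
  set ε : ℝ := min ((A / (2 * A')) ^ 3) (B / 6) with hεdef
  have hε : 0 < ε := lt_min (by positivity) (by positivity)
  obtain ⟨x₀, hx₀⟩ := exists_log_pow_four_le ε hε
  obtain ⟨j₁, hj₁⟩ : ∃ j₁ : ℕ, x₀ / Real.log 2 ≤ j₁ := exists_nat_ge _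
  have hlog2 : 0 < Real.log 2 := Real.log_pos (by norm_num)
  have hlog2lt : Real.log 2 < 1 := by
    have := Real.log_two_lt_d9; linarith
  have hlog2gt : 1 / 2 < Real.log 2 := by
    have := Real.log_two_gt_d9; linarith
  refine ⟨max (max γ₀ j₁) 8, fun j hj χ hχ ρ hρ _ _ hγ => ?_⟩
  have hjγ₀ : γ₀ ≤ j := le_trans (le_trans (le_max_left _ _) (le_max_left _ _)) hj
  have hjj₁ : j₁ ≤ j := le_trans (le_trans (le_max_right _ _) (le_max_left _ _)) hj
  have hj8 : 8 ≤ j := le_trans (le_max_right _ _) hj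
  have hjR : (8 : ℝ) ≤ j := by exact_mod_cast hj8
  have hjpos : (0 : ℝ) < j := by linarith
  -- the variable `x = log q = j log 2` and `L = log x`
  set x : ℝ := Real.log ((2 : ℝ) ^ j) with hxdef
  have hxj : x = j * Real.log 2 := by rw [hxdef, Real.log_pow]
  have hx0 : x₀ ≤ x := by
    rw [hxj]
    have : x₀ / Real.log 2 ≤ j := le_trans hj₁ (by exact_mod_cast hjj₁)
    rw [div_le_iff₀ hlog2] at this
    linarith
  have hxe : Real.exp 1 ≤ x := by
    rw [hxj]
    have := Real.exp_one_lt_d9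
    nlinarith
  have hxpos : 0 < x := lt_of_lt_of_le (Real.exp_pos 1) hxe
  have hx1 : 1 ≤ x := le_trans (by have := Real.add_one_le_exp (1 : ℝ); linarith) hxe
  set L : ℝ := Real.log x with hLdef
  have hL1 : 1 ≤ L := by
    rw [hLdef, ← Real.log_exp 1]
    exact Real.log_le_log (Real.exp_pos 1) hxe
  have hL0 : 0 ≤ L := by linarith
  -- `log j ≤ 2 L` (as `j ≤ 2 x` and `log 2 ≤ 1 ≤ L`)
  have hlogj : Real.log j ≤ 2 * L := by
    have hj2x : (j : ℝ) ≤ 2 * x := by rw [hxj]; nlinarith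
    have h1 : Real.log j ≤ Real.log (2 * x) := Real.log_le_log hjpos hj2x
    rw [Real.log_mul (by norm_num) hxpos.ne'] at h1
    linarith
  have hlogj0 : 0 ≤ Real.log j := Real.log_nonneg (by linarith)
  -- the key estimate `L^4 ≤ ε x`
  have hkey : L ^ 4 ≤ ε * x := hx₀ x hx0
  -- (a) the width: `A' log j / j ≤ A / (x^{2/3} L^{1/3})`
  have hx13 : 0 < x ^ (1 / 3 : ℝ) := Real.rpow_pos_of_pos hxpos _
  have hx23 : 0 < x ^ (2 / 3 : ℝ) := Real.rpow_pos_of_pos hxpos _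
  have hL13 : 1 ≤ L ^ (1 / 3 : ℝ) := Real.one_le_rpow hL1 (by norm_num)
  have hL13' : 0 < L ^ (1 / 3 : ℝ) := by linarith
  have hwidth : A' * Real.log j / j ≤ A / (x ^ (2 / 3 : ℝ) * L ^ (1 / 3 : ℝ)) := by
    -- `L^{4/3} ≤ (A/(2A')) x^{1/3}`
    have h43 : L ^ (4 / 3 : ℝ) ≤ A / (2 * A') * x ^ (1 / 3 : ℝ) := by
      refine rpow_four_thirds_le hL0 (by positivity) hxpos.le ?_
      calc L ^ 4 ≤ ε * x := hkey
        _ ≤ (A / (2 * A')) ^ 3 * x := mul_le_mul_of_nonneg_right (min_le_left _ _) hxpos.le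
    -- `L^{4/3} = L · L^{1/3}` and `x = x^{2/3} x^{1/3}`
    have hL43 : L ^ (4 / 3 : ℝ) = L * L ^ (1 / 3 : ℝ) := by
      rw [show (4 / 3 : ℝ) = 1 + 1 / 3 by norm_num, Real.rpow_add (by linarith), Real.rpow_one]
    have hxsplit : x = x ^ (2 / 3 : ℝ) * x ^ (1 / 3 : ℝ) := by
      rw [← Real.rpow_add hxpos]; norm_num
    rw [div_le_div_iff₀ hjpos (by positivity)]
    -- goal: `A' * log j * (x^{2/3} L^{1/3}) ≤ A * j`
    have hjx : x ≤ (j : ℝ) := by rw [hxj]; nlinarith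
    calc A' * Real.log j * (x ^ (2 / 3 : ℝ) * L ^ (1 / 3 : ℝ))
        ≤ A' * (2 * L) * (x ^ (2 / 3 : ℝ) * L ^ (1 / 3 : ℝ)) := by gcongr
      _ = 2 * A' * (L * L ^ (1 / 3 : ℝ)) * x ^ (2 / 3 : ℝ) := by ring
      _ = 2 * A' * L ^ (4 / 3 : ℝ) * x ^ (2 / 3 : ℝ) := by rw [hL43]
      _ ≤ 2 * A' * (A / (2 * A') * x ^ (1 / 3 : ℝ)) * x ^ (2 / 3 : ℝ) := by gcongr
      _ = A * (x ^ (2 / 3 : ℝ) * x ^ (1 / 3 : ℝ)) := by field_simp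
      _ = A * x := by rw [← hxsplit]
      _ ≤ A * j := mul_le_mul_of_nonneg_left hjx hA.le
  -- (b) the height: `j³ ≤ T`
  have hheight : (j : ℝ) ^ 3 ≤ Real.exp (B * x ^ (5 / 3 : ℝ) * L ^ (1 / 3 : ℝ)) := by
    have hj3 : ((j : ℝ) ^ 3) = Real.exp (3 * Real.log j) := by
      rw [show (3 : ℝ) * Real.log j = Real.log ((j : ℝ) ^ 3) by rw [Real.log_pow]; norm_num,
        Real.exp_log (by positivity)]
    rw [hj3, Real.exp_le_exp]
    -- `3 log j ≤ 6 L ≤ B x ≤ B x^{5/3} L^{1/3}`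
    have hLx : 6 * L ≤ B * x := by
      have hL4 : L ≤ L ^ 4 := by
        calc L = L ^ 1 := (pow_one L).symm
          _ ≤ L ^ 4 := pow_le_pow_right₀ hL1 (by norm_num)
      have : L ≤ B / 6 * x := le_trans hL4 (le_trans hkey (mul_le_mul_of_nonneg_right (min_le_right _ _) hxpos.le))
      linarith
    have hx53 : x ≤ x ^ (5 / 3 : ℝ) := by
      calc x = x ^ (1 : ℝ) := (Real.rpow_one x).symm
        _ ≤ x ^ (5 / 3 : ℝ) := Real.rpow_le_rpow_of_exponent_le hx1 (by norm_num)
    calc 3 * Real.log j ≤ 3 * (2 * L) := by gcongr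
      _ = 6 * L := by ring
      _ ≤ B * x := hLx
      _ = B * x * 1 := (mul_one _).symm
      _ ≤ B * x ^ (5 / 3 : ℝ) * L ^ (1 / 3 : ℝ) := by gcongr
  -- conclude from the zero-free region
  have hT : |ρ.im| ≤ Real.exp (B * Real.log ((2 : ℝ) ^ j) ^ (5 / 3 : ℝ) *
      Real.log (Real.log ((2 : ℝ) ^ j)) ^ (1 / 3 : ℝ)) := le_trans hγ hheight
  have hz := hZ j hjγ₀ χ hχ ρ hρ hT
  calc ρ.re ≤ 1 - A / (x ^ (2 / 3 : ℝ) * L ^ (1 / 3 : ℝ)) := hz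
    _ ≤ 1 - A' * Real.log j / j := by linarith

/-- ★ **`AlignedTypeI` from the published zero-free region for `2`-power moduli** (Banks–Shparlinski 2019, Thm 7.2,
first clause, `q = 2^γ`; CONDITIONAL by arrow on that named fact): compose `twoPowerZFR_of_BS72` with
`alignedTypeI_of_twoPowerZFR`. [cite: BanksShparlinski2019PowerfulModuli, Theorem 7.2] -/
theorem alignedTypeI_of_BS72 (h : Literature.NumberTheory.LFunctions.BanksShparlinski2019_theorem72_twoPower) :
    Summit.ValiantsHypothesis.ValiantsHypothesis.Theses.LiouvilleSarnak.AlignedTypeI :=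
  alignedTypeI_of_twoPowerZFR (twoPowerZFR_of_BS72 h)

end Summit.ValiantsHypothesis.ValiantsHypothesis.Theorems.LiouvilleSarnak.AlignedTypeI.CharactersModTwoN
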